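import Mathlib
import HarnessLib
import Summits.HubbardSuperconductivity.HubbardSuperconductivity.Theorems.KLProgrammeKLRegimeTwoVolumeLipBornDiffHstep
import Summits.HubbardSuperconductivity.HubbardSuperconductivity.Theorems.KLProgrammeKLRegimeEngineTowerKitStepLipNonneg

/-!
# Route `KLProgramme` — crux K3 ENGINE (stmt-HubbardSuperconductivity-20437), stub (e) proof-input «(e)-D-ROWS»: THE (Db) `hstep` ROW IN SUP FORM
# (seat hubbard-kl-k3c4-p1 g24; `--supports` 20437; DROWS-SCOPE-g24 v10 §12.3)

`…TwoVolumeLipBornDiffHstep.klLipBornDiff_pinned_le_hstep` holds at every `(D₀+r)`-deep output pin with a pin-independent right side; its right side is nonnegative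
(`EngineV8.kitStepLip_nonneg` under the kit guard, SRC by positivity), so `…LipDiffSups.klLipBornDiffSup_le_of_forall` turns it into the bound on the deep-pin
SUPREMUM `klLipBornDiffSup … d k (n+1) (D₀+r)` — the object T3-Lip's born-difference array is made of (`db (k+1) q := klLipBornDiffSup …/(cW^{2q}u^qKc)`).

* **`klLipBornDiffSup_le_hstep`**.

A composition of landed theorems; nothing asserts the (D) rows, stub (e), VL, K3 or superconductivity.
References: BGM 2006 §2.8, §3 [cite: BenfattoGiulianiMastropietro2006].
-/

noncomputable section

namespace Summit.HubbardSuperconductivity.HubbardSuperconductivity.Theorems.TwoVolumeLip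

set_option linter.dupNamespace false -- summit = problem name (single-conjunct summit), D-0017

open Finset Literature.MathematicalPhysics.QuantumLattice GrassmannAlgebra Literature.Probability.LatticeModels
  Literature.Probability.LatticeModels.BattleFederbush
open Literature.MathematicalPhysics.QuantumLattice.FermiRG
open Summit.HubbardSuperconductivity.HubbardSuperconductivity.Theorems.KLRegimeSplit
open Summit.HubbardSuperconductivity.HubbardSuperconductivity.Theorems.KLProgrammeLegKernels
open Summit.HubbardSuperconductivity.HubbardSuperconductivity.Theorems.DispersionFlow
open Summit.HubbardSuperconductivity.HubbardSuperconductivity.Theorems.EngineV8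
open Summit.HubbardSuperconductivity.HubbardSuperconductivity.Theorems.TwoVolumeSource
open Summit.HubbardSuperconductivity.HubbardSuperconductivity.Theorems.TwoVolumeDefect

variable {L b M : ℕ} [NeZero L] [NeZero (b * L)] [NeZero M]

set_option maxHeartbeats 400000 in -- large statement
/-- **The (Db) `hstep` row in sup form**: hypotheses of `klLipBornDiff_pinned_le_hstep` (all pin-independent), conclusion for `klLipBornDiffSup … d k (n+1) (D₀+r)`. -/
theorem klLipBornDiffSup_le_hstep {β : ℝ} (hβ : 0 < β) (U μ : ℝ) (K : TrigPolyC4v) {d k : ℕ} (hdk : 1 ≤ d * k)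
    (hZf : hubbardEffPartitionFnCT (b * L) M β U μ 0 K (klScale klE0 (d * k)) ≠ 0)
    (hZc : hubbardEffPartitionFnCT L M β U μ 0 K (klScale klE0 (d * k)) ≠ 0)
    {κ : ℝ} (hκ : 0 < κ) (hGB : IsGramBoundedR ((sectorSubMatrix (b * L) M β (bgmFatMultiplier (b * L) M klE0 β (nambuXiCT (b * L) μ K) (d * k - 1))).transpose * hubbardCovSliceCT (b * L) M β μ 0 K (klScale klE0 (d * (k + 1))) (klScale klE0 (d * k)) * sectorSubMatrix (b * L) M β (bgmFatMultiplier (b * L) M klE0 β (nambuXiCT (b * L) μ K) (d * k - 1))) κ)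
    {u Kc : ℝ} (hu : 0 < u) (hKc : 0 < Kc) (bV bD : ℕ → ℝ) (hbV0 : ∀ m', 0 ≤ bV m') (hbD0 : ∀ m', 0 ≤ bD m')
    (hNV : ∀ m' (j : Fin (2 * m')) (x : (SpaceTimeIdx (b * L) M × SectorLeg (sectorCount (d * k - 1)))), ∑ Y ∈ univ.filter (fun Y : Fin (2 * m') → (SpaceTimeIdx (b * L) M × SectorLeg (sectorCount (d * k - 1))) => Y j = x),
      ‖kernel ℂ (klGlue L b M (sectorCount (d * k - 1)) (klLipInput L M β U μ K d k)) (2 * m') Y‖ * klGluedWt L b M β (d * k - 1) (sectorCount (d * k - 1)) (univ.image Y) ≤ Kc * (u ^ m' * bV m'))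
    (hND : ∀ m' (j : Fin (2 * m')) (x : (SpaceTimeIdx (b * L) M × SectorLeg (sectorCount (d * k - 1)))), ∑ Y ∈ univ.filter (fun Y : Fin (2 * m') → (SpaceTimeIdx (b * L) M × SectorLeg (sectorCount (d * k - 1))) => Y j = x),
      ‖kernel ℂ (klLipInputDiff L b M β U μ K d k) (2 * m') Y‖ * klGluedWt L b M β (d * k - 1) (sectorCount (d * k - 1)) (univ.image Y) ≤ Kc * (u ^ m' * bD m'))
    (R R' : ℕ) (bE : ℕ → ℝ) (hbE0 : ∀ m', 0 ≤ bE m') (hE : ∀ m', klLipInputDiffSup L b M β U μ K d k (2 * m') R ≤ Kc * (u ^ m' * bE m'))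
    (hbV00 : bV 0 = 0) (hbD00 : bD 0 = 0) (hbE00 : bE 0 = 0)
    {α : ℝ} (hα : 0 < α)
    (hrow : ∀ X, ∑ Y, ‖((sectorSubMatrix (b * L) M β (bgmFatMultiplier (b * L) M klE0 β (nambuXiCT (b * L) μ K) (d * k - 1))).transpose * hubbardCovSliceCT (b * L) M β μ 0 K (klScale klE0 (d * (k + 1))) (klScale klE0 (d * k)) * sectorSubMatrix (b * L) M β (bgmFatMultiplier (b * L) M klE0 β (nambuXiCT (b * L) μ K) (d * k - 1))) X Y‖ * klGluedWt L b M β (d * k - 1) (sectorCount (d * k - 1)) {X, Y} ≤ α)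
    (hcol : ∀ Y, ∑ X, ‖((sectorSubMatrix (b * L) M β (bgmFatMultiplier (b * L) M klE0 β (nambuXiCT (b * L) μ K) (d * k - 1))).transpose * hubbardCovSliceCT (b * L) M β μ 0 K (klScale klE0 (d * (k + 1))) (klScale klE0 (d * k)) * sectorSubMatrix (b * L) M β (bgmFatMultiplier (b * L) M klE0 β (nambuXiCT (b * L) μ K) (d * k - 1))) X Y‖ * klGluedWt L b M β (d * k - 1) (sectorCount (d * k - 1)) {X, Y} ≤ α)
    {ρ : ℝ} (hρ : 0 < ρ)
    {D : ℕ} (hD : Fintype.card (SpaceTimeIdx (b * L) M × SectorLeg (sectorCount (d * k - 1))) / 2 ≤ D)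
    (hg₁ : Real.exp 1 * α / κ ^ 2 * Kc * towerV D ((Real.exp 2 * (κ + ρ)) ^ 2 * u) (fun m => bV m + bD m + bE m) < 1)
    (hg₂ : Real.exp 1 * α / κ ^ 2 * Kc * towerV D ((Real.exp 2 * (κ + ρ)) ^ 2 * u) (fun m => bV m + bD m) < 1)
    {N₀ : ℕ} (hN₀ : 2 ≤ N₀)
    {Λ : ℝ} (hΛ1 : 1 ≤ Λ) (hΛle : Λ ≤ 1 + klScale klE0 (d * k - 1) * ((R' : ℝ) + 1))
    (jr : ℕ) {ΛT cW : ℝ} (hΛT : 0 ≤ ΛT) (hΛr : ΛT ≤ klScale klE0 jr) (hcW : 0 < cW)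
    (hrowT : ∀ x, ∑ y', ‖klLipTransfer (b * L) M β μ K d k x y'‖ *
      klScaleWt (b * L) M β jr {latticeLegPos (2 * (2 * M)) x, latticeLegPos (2 * (2 * M)) y'} ≤ cW)
    (hcolT : ∀ y', ∑ x, ‖klLipTransfer (b * L) M β μ K d k x y'‖ *
      klScaleWt (b * L) M β jr {latticeLegPos (2 * (2 * M)) x, latticeLegPos (2 * (2 * M)) y'} ≤ cW)
    (D₀ r : ℕ) (hD₀ : 2 * r ≤ D₀) (hRR' : R + R' ≤ D₀)
    {n q : ℕ} (hq : 2 * q = n + 1)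
    {N Nfar Es NDs : ℝ} (hN0 : 0 ≤ N) (hNfar0 : 0 ≤ Nfar) (hEs0 : 0 ≤ Es) (hNDs0 : 0 ≤ NDs)
    (hN : ∀ (p : Fin (n + 1)) y, ∑ Y ∈ univ.filter (fun Y : Fin (n + 1) → SpaceTimeIdx L M × SectorLeg (sectorCount (d * k - 1)) => Y p = y),
      ‖kernel ℂ (effAction ℂ (klLipCov L M β μ K d k) (klLipInput L M β U μ K d k) - klLipInput L M β U μ K d k) (n + 1) Y‖ ≤ N)
    (hNfar : ∀ (p : Fin (n + 1)) y (i : Fin (n + 1)),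
      ∑ Y ∈ univ.filter (fun Y : Fin (n + 1) → SpaceTimeIdx L M × SectorLeg (sectorCount (d * k - 1)) => Y p = y ∧ r < Torus.tnorm ((Y p).1.2 - (Y i).1.2)),
        ‖kernel ℂ (effAction ℂ (klLipCov L M β μ K d k) (klLipInput L M β U μ K d k) - klLipInput L M β U μ K d k) (n + 1) Y‖ ≤ Nfar)
    (hEs : ∀ (p : Fin (n + 1)) (y' : SpaceTimeIdx (b * L) M × SectorLeg (sectorCount (d * k - 1))), y' ∈ klDeepPins L D₀ →
      ∑ Y' ∈ univ.filter (fun Y' : Fin (n + 1) → SpaceTimeIdx (b * L) M × SectorLeg (sectorCount (d * k - 1)) => Y' p = y'),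
        ‖kernel ℂ ((effAction ℂ (klLipCov (b * L) M β μ K d k) (klGlue L b M (sectorCount (d * k - 1)) (klLipInput L M β U μ K d k)) -
              klGlue L b M (sectorCount (d * k - 1)) (klLipInput L M β U μ K d k)) -
            klGlue L b M (sectorCount (d * k - 1))
              (effAction ℂ (klLipCov L M β μ K d k) (klLipInput L M β U μ K d k) - klLipInput L M β U μ K d k)) (n + 1) Y'‖ ≤ Es)
    (hNDs : ∀ (p : Fin (n + 1)) (y' : SpaceTimeIdx (b * L) M × SectorLeg (sectorCount (d * k - 1))),
      ∑ Y' ∈ univ.filter (fun Y' : Fin (n + 1) → SpaceTimeIdx (b * L) M × SectorLeg (sectorCount (d * k - 1)) => Y' p = y'),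
        ‖kernel ℂ ((effAction ℂ (klLipCov (b * L) M β μ K d k) (klGlue L b M (sectorCount (d * k - 1)) (klLipInput L M β U μ K d k)) -
              klGlue L b M (sectorCount (d * k - 1)) (klLipInput L M β U μ K d k)) -
            klGlue L b M (sectorCount (d * k - 1))
              (effAction ℂ (klLipCov L M β μ K d k) (klLipInput L M β U μ K d k) - klLipInput L M β U μ K d k)) (n + 1) Y'‖ ≤ NDs)
    :
    klLipBornDiffSup L b M β U μ K d k (n + 1) (D₀ + r) ≤
      cW ^ (2 * q - 1) * (u ^ q * Kc) * (cW *
        (towerFO D (κ ^ 2 * u) (fun m => bE m + (Λ⁻¹ + 1 / (1 + ΛT * ((r : ℝ) + 1))) * bD m) q +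
          (∑ n' ∈ Icc 2 (N₀ - 1), Real.exp 1 * (Real.exp 1 * α / κ ^ 2 * Kc) ^ (n' - 1) * (ρ⁻¹ ^ 2 / u) ^ q * towerSLip D ((Real.exp 2 * (κ + ρ)) ^ 2 * u) (fun m => bE m + (Λ⁻¹ + 1 / (1 + ΛT * ((r : ℝ) + 1))) * bD m) (fun m => bV m + bD m + bE m) n' q) +
          (4 + 2 * (1 / (1 + ΛT * ((r : ℝ) + 1)))) * ((ρ⁻¹ ^ 2 / u) ^ q * Real.exp 1 * towerV D ((Real.exp 2 * (κ + ρ)) ^ 2 * u) (fun m => bV m + bD m + bE m) *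
            ((Real.exp 1 * α / κ ^ 2 * Kc) * towerV D ((Real.exp 2 * (κ + ρ)) ^ 2 * u) (fun m => bV m + bD m + bE m)) ^ (N₀ - 1) / (1 - (Real.exp 1 * α / κ ^ 2 * Kc) * towerV D ((Real.exp 2 * (κ + ρ)) ^ 2 * u) (fun m => bV m + bD m + bE m))))) +
      (cW ^ n * (cW * Es + cW / (1 + ΛT * ((r : ℝ) + 1)) * NDs) +
        (2 * cW ^ n * (cW / (1 + ΛT * ((r : ℝ) + 1))) * N + n * cW ^ n * (5 * (cW / (1 + ΛT * ((r : ℝ) + 1))) * N + 2 * cW * Nfar))) := by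
  have hμ0 : ∀ m, 0 ≤ (fun m => bV m + bD m + bE m) m := fun m => add_nonneg (add_nonneg (hbV0 m) (hbD0 m)) (hbE0 m)
  have ht : 0 ≤ 1 / (1 + ΛT * ((r : ℝ) + 1)) := by positivity
  have hν0 : ∀ m, 0 ≤ (fun m => bE m + (Λ⁻¹ + 1 / (1 + ΛT * ((r : ℝ) + 1))) * bD m) m := fun m => by
    have h1 := hbE0 m; have h2 := hbD0 m; have h3 : 0 ≤ Λ⁻¹ := inv_nonneg.2 (zero_le_one.trans hΛ1)
    dsimp only; positivity
  have hS := kitStepLip_nonneg (D := D) (N := N₀ - 1) (q := q) (σ := κ ^ 2 * u) (τ := (Real.exp 2 * (κ + ρ)) ^ 2 * u)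
    (Φ := Real.exp 1 * α / κ ^ 2 * Kc) (ψ := ρ⁻¹ ^ 2 / u) (Ct := 4 + 2 * (1 / (1 + ΛT * ((r : ℝ) + 1))))
    (ν := fun m => bE m + (Λ⁻¹ + 1 / (1 + ΛT * ((r : ℝ) + 1))) * bD m) (μ := fun m => bV m + bD m + bE m)
    (by positivity) (by positivity) (by positivity) (by positivity) (by positivity) hν0 hμ0 hg₁
  have hτ0 : 0 ≤ cW / (1 + ΛT * ((r : ℝ) + 1)) := by have := hcW.le; positivity
  refine klLipBornDiffSup_le_of_forall β U μ K d k (n + 1) (D₀ + r) ?_ fun p w'' hw'' =>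
    klLipBornDiff_pinned_le_hstep hβ U μ K hdk hZf hZc hκ hGB hu hKc bV bD hbV0 hbD0 hNV hND R R' bE hbE0 hE hbV00 hbD00 hbE00 hα hrow hcol hρ hD hg₁ hg₂
      hN₀ hΛ1 hΛle jr hΛT hΛr hcW hrowT hcolT D₀ r hD₀ hRR' hq hN0 hNfar0 hEs0 hNDs0 hN hNfar hEs hNDs p w'' hw''
  have hcW0 := hcW.le
  exact add_nonneg (mul_nonneg (by positivity) (mul_nonneg hcW0 hS)) (by positivity)

end Summit.HubbardSuperconductivity.HubbardSuperconductivity.Theorems.TwoVolumeLip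

end
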